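import Mathlib
import Summits.PneNP.PneNP.Theorems.SymmetryBudgetWindowBarrierStubTwinIsoHardOfCoreFooling

/-!
# HardToIdentify ⟹ TwinIsoHard (crux `SymmetryBudget.WindowBarrier`, item stmt-PneNP-2145,
line `bijection-gauge-twin-iso`, stub S_H)

The second bridge of the chain (★) CoreFooling ⟹ HardToIdentify ⟹ TwinIsoHard
(`hardToIdentify_of_coreFooling` is `SymmetryBudgetWindowBarrierHardToIdentify.lean`):

* `TwinIso.exists_core_circuit_raw` — the relocation of `TwinIso.exists_core_circuit_pat` with the
  evaluation clause for ARBITRARY matrices on the live block (not only adjacency matrices), so that the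
  relocated circuit COMPUTES a function in the sense of `Circuit.Computes` / `HasSymCircuit`;
* `TwinIso.not_hasSymCircuit_twinIso_of_identifier` — planting a fixed graph `H` on the first free half:
  a `Bud(m, 2h)`-symmetric twin-isomorphism circuit of size `s` yields a `Sym(Fin h)`-symmetric circuit of
  size `s + 2` computing the identifier `y ↦ [Gr y ≅ H]`;
* `twinIsoHard_of_hardToIdentify` — HardToIdentify (for every `c`, infinitely often some `h`-vertex `H`
  has no `Sym(Fin h)`-symmetric `tcBasis` identifier with `≤ 2^{ch}` gates) implies the registered stub
  `stub_twinIsoHard` verbatim (take `m = 4^h`).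

So the open stub of the line is implied by HardToIdentify, itself implied by (★); HardToIdentify is the
recommended promotion target (one explicit function per witness graph, no `P`/TM content). Kernel-only
helper file (no definitions).
-/

-- `Summit.PneNP.PneNP.…` duplicates `PneNP` BY DESIGN (single-problem summit).
set_option linter.dupNamespace false

namespace Summit.PneNP.PneNP.Theorems

open Literature.Computability.Complexity Literature.Computability.Complexity.GateList Filter
open scoped Classical
open CoreReduction

namespace TwinIso

/-- **The planting wiring over a background, raw form.** As `exists_plantWire_pat`, but the value clause
reads an ARBITRARY `g × g` matrix `y` off the live block: the wire of `q` carries `y (q - n)` on the live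
block and the background bit `pat q` elsewhere. -/
theorem exists_plantWire_raw (n g : ℕ) (pat : Fin (n + g) × Fin (n + g) → Bool) :
    ∃ φ : Fin (n + g) × Fin (n + g) → (Fin g × Fin g) ⊕ ℕ,
      WiresOK 2 φ ∧
      (∀ (y : Fin g × Fin g → Bool) (q : Fin (n + g) × Fin (n + g)),
        wireOf y [true, false] (φ q) =
          if hq : n ≤ (q.1 : ℕ) ∧ n ≤ (q.2 : ℕ) then y (⟨q.1 - n, by omega⟩, ⟨q.2 - n, by omega⟩)
          else pat q) ∧
      ((∀ q : Fin (n + g) × Fin (n + g), pat q = true → (q.1 : ℕ) < n ∧ (q.2 : ℕ) < n) →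
      ∀ (σ : Equiv.Perm (Fin g)) (ρ : Equiv.Perm (Fin (n + g))),
        (∀ i : Fin (n + g), (i : ℕ) < n → ρ i = i) →
        (∀ i : Fin (n + g), n ≤ ((ρ i : Fin (n + g)) : ℕ) ↔ n ≤ (i : ℕ)) →
        (∀ (i : Fin (n + g)) (h : n ≤ (i : ℕ)), ρ i = ⟨n + σ ⟨i - n, by omega⟩, freeIdx_lt n _⟩) →
        ∀ q : Fin (n + g) × Fin (n + g),
          φ (ρ q.1, ρ q.2) = Sum.map (fun p : Fin g × Fin g => (σ p.1, σ p.2)) id (φ q)) := by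
  obtain ⟨φ₀, -, -, hφσ⟩ := exists_plantWire_pat n g pat
  -- we rebuild the same wiring explicitly (its value clause is needed for raw matrices)
  refine ⟨fun q => if h : n ≤ (q.1 : ℕ) ∧ n ≤ (q.2 : ℕ) then
      Sum.inl (⟨q.1 - n, by omega⟩, ⟨q.2 - n, by omega⟩) else
      if pat q = true then Sum.inr 0 else Sum.inr 1, ?_, ?_, ?_⟩
  · intro q k hk
    dsimp only at hk
    by_cases h : n ≤ (q.1 : ℕ) ∧ n ≤ (q.2 : ℕ)
    · rw [dif_pos h] at hk
      cases hk
    · rw [dif_neg h] at hk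
      split_ifs at hk <;> (simp only [Sum.inr.injEq] at hk; omega)
  · intro y q
    dsimp only
    by_cases h : n ≤ (q.1 : ℕ) ∧ n ≤ (q.2 : ℕ)
    · rw [dif_pos h, dif_pos h, wireOf_inl]
    · rw [dif_neg h, dif_neg h]
      cases pat q <;> rfl
  · clear hφσ φ₀
    intro hpat σ ρ hρlt hρfree hρval q
    dsimp only
    by_cases h : n ≤ (q.1 : ℕ) ∧ n ≤ (q.2 : ℕ)
    · have h' : n ≤ ((ρ q.1 : Fin (n + g)) : ℕ) ∧ n ≤ ((ρ q.2 : Fin (n + g)) : ℕ) :=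
        ⟨(hρfree q.1).2 h.1, (hρfree q.2).2 h.2⟩
      rw [dif_pos h', dif_pos h]
      simp only [Sum.map_inl, Sum.inl.injEq, Prod.mk.injEq]
      constructor
      · apply Fin.ext; simp [hρval q.1 h.1]
      · apply Fin.ext; simp [hρval q.2 h.2]
    · have h' : ¬ (n ≤ ((ρ q.1 : Fin (n + g)) : ℕ) ∧ n ≤ ((ρ q.2 : Fin (n + g)) : ℕ)) := by
        rw [hρfree, hρfree]; exact h
      have hpq : pat (ρ q.1, ρ q.2) = pat q := by
        by_cases hb : (q.1 : ℕ) < n ∧ (q.2 : ℕ) < n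
        · rw [hρlt q.1 hb.1, hρlt q.2 hb.2]
        · have h1 : pat q = false := by
            cases hc : pat q
            · rfl
            · exact absurd (hpat q hc) hb
          have h2 : pat (ρ q.1, ρ q.2) = false := by
            cases hc : pat (ρ q.1, ρ q.2)
            · rfl
            · exfalso
              have hc' := hpat _ hc
              change ((ρ q.1 : Fin (n + g)) : ℕ) < n ∧ ((ρ q.2 : Fin (n + g)) : ℕ) < n at hc'
              have h3 : ¬ n ≤ (q.1 : ℕ) := fun hh => absurd ((hρfree q.1).2 hh) (by omega)
              have h4 : ¬ n ≤ (q.2 : ℕ) := fun hh => absurd ((hρfree q.2).2 hh) (by omega)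
              exact hb ⟨by omega, by omega⟩
          rw [h1, h2]
      rw [dif_neg h', dif_neg h, hpq]
      cases pat q <;> rfl

/-- **Circuit transfer over a background pattern, raw form.** A `Bud(n+g, g)`-symmetric
`tcBasis`-circuit on `(n+g) × (n+g)` inputs yields, for every background `pat` supported on the ordered
block, a `Sym(Fin g)`-symmetric `tcBasis`-circuit on `g × g` inputs with two more gates whose value on
EVERY matrix `y` is the value of the former on `y` planted on the live block over `pat`. -/
theorem exists_core_circuit_raw (n g : ℕ) (pat : Fin (n + g) × Fin (n + g) → Bool)
    (hpat : ∀ q : Fin (n + g) × Fin (n + g), pat q = true → (q.1 : ℕ) < n ∧ (q.2 : ℕ) < n)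
    (C : Circuit (Fin (n + g) × Fin (n + g)))
    (hB : C.IsOver tcBasis) (hsym : C.IsSymmetricUnder (pointStabiliserBudget (n + g) g)) :
    ∃ D : Circuit (Fin g × Fin g), D.IsOver tcBasis ∧ D.size = C.size + 2 ∧
      D.IsSymmetricUnder Set.univ ∧
      ∀ y : Fin g × Fin g → Bool,
        D.eval y = C.eval (fun q => if hq : n ≤ (q.1 : ℕ) ∧ n ≤ (q.2 : ℕ) then
          y (⟨q.1 - n, by omega⟩, ⟨q.2 - n, by omega⟩) else pat q) := by
  obtain ⟨φ, hφ2, hφv, hφσ⟩ := exists_plantWire_raw n g pat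
  obtain ⟨pre, hpreL, hpre0, hpreB, hpreV, hpreWF⟩ :=
    HeaderHardwiring.exists_constPre (Fin g × Fin g)
  have hφ : WiresOK pre.length φ := by rw [hpreL]; exact hφ2
  obtain ⟨D, hDg, hDo⟩ := exists_hardwire₂ pre hpreWF C φ hφ
  refine ⟨D, isOver_hardwire₂ pre hpreB C D hB φ pre.length hDg, ?_, ?_, ?_⟩
  · rw [size_hardwire₂ pre C D φ pre.length hDg, hpreL]
  · intro σ _
    obtain ⟨ρ, hρlt, -, hρfree, hρval, hρbud⟩ := exists_extendPerm n σ
    obtain ⟨τ, hτ⟩ := hsym ρ hρbud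
    exact exists_isInducedAut_hardwire₂ pre hpre0 C D φ hφ hDg hDo
      (π := fun q : Fin (n + g) × Fin (n + g) => (ρ q.1, ρ q.2))
      (π' := fun p : Fin g × Fin g => (σ p.1, σ p.2))
      (fun q => hφσ hpat σ ρ hρlt hρfree hρval q) hτ
  · intro y
    rw [eval_hardwire₂ pre C D φ hφ hDg hDo, hpreV]
    exact congrArg C.eval (funext fun q => hφv y q)

/-- Along an equivalence `↥s ≃ W` intertwining two relations, the subgraph of `fromRel R` induced on
`s` is isomorphic to `fromRel R'` (no symmetry of `R`, `R'` needed: both sides symmetrise). -/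
theorem nonempty_induce_iso_fromRel {V W : Type*} (R : V → V → Prop) (s : Set V) (R' : W → W → Prop)
    (e : ↥s ≃ W) (hR : ∀ a b : ↥s, R a b ↔ R' (e a) (e b)) :
    Nonempty ((SimpleGraph.fromRel R).induce s ≃g SimpleGraph.fromRel R') := by
  refine ⟨⟨e, fun {a b} => ?_⟩⟩
  show (SimpleGraph.fromRel R').Adj (e a) (e b) ↔ (SimpleGraph.fromRel R).Adj a b
  rw [SimpleGraph.fromRel_adj, SimpleGraph.fromRel_adj]
  have hne : e a ≠ e b ↔ (a : V) ≠ (b : V) := by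
    rw [Ne, Ne, e.injective.eq_iff, Subtype.ext_iff]
  rw [hne, ← hR a b, ← hR b a]

/-- **An identifier from a twin-isomorphism circuit.** On `m = n + h + h` vertices (`0 < n`, free part
of size `g = h + h`): if NO `Sym(Fin h)`-symmetric `tcBasis`-circuit of size `≤ s + 2` computes the
identifier `y ↦ [Gr y ≅ H]` of the fixed graph `H` on `Fin h`, then no `Bud(m, g)`-symmetric
`tcBasis`-circuit of size `≤ s` computes the twin-isomorphism bit (plant `H` on `A₀ × A₀`, the marker
row, and read the live graph on `B₀ × B₀`). -/
theorem not_hasSymCircuit_twinIso_of_identifier (n h g s : ℕ) (hn : 0 < n) (hg : g = h + h)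
    (H : SimpleGraph (Fin h))
    (hH : ¬ HasSymCircuit tcBasis Set.univ (s + 2)
      (fun y : Fin h × Fin h → Bool =>
        decide (Nonempty ((SimpleGraph.fromRel fun u v => y (u, v) = true) ≃g H)))) :
    ¬ HasSymCircuit tcBasis (pointStabiliserBudget (n + h + h) g) s
        (fun x : Fin (n + h + h) × Fin (n + h + h) → Bool => decide (Nonempty
          (SimpleGraph.induce {u : Fin (n + h + h) | n + h + h ≤ (u : ℕ) + g ∧ ∃ h0 : 0 < n + h + h, (SimpleGraph.fromRel fun u v => x (u, v) = true).Adj ⟨0, h0⟩ u}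
              (SimpleGraph.fromRel fun u v => x (u, v) = true) ≃g
            SimpleGraph.induce {u : Fin (n + h + h) | n + h + h ≤ (u : ℕ) + g ∧ ¬ ∃ h0 : 0 < n + h + h, (SimpleGraph.fromRel fun u v => x (u, v) = true).Adj ⟨0, h0⟩ u}
              (SimpleGraph.fromRel fun u v => x (u, v) = true)))) := by
  subst hg
  rintro ⟨C, hB, hsize, hsym, hcomp⟩
  obtain ⟨pat, hP1, hP2, hP4, hP3⟩ := exists_twinPat n h hn H
  have hsym' : C.IsSymmetricUnder (pointStabiliserBudget (n + h + h) h) :=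
    hsym.mono (pointStabiliserBudget_mono _ (Nat.le_add_left h h))
  obtain ⟨D, hDB, hDs, hDsym, hDev⟩ := exists_core_circuit_raw (n + h) h pat hP1 C hB hsym'
  apply hH
  refine ⟨D, hDB, by omega, hDsym, fun y => ?_⟩
  rw [hDev y, hcomp]
  -- the planted input of `y`
  set x : Fin (n + h + h) × Fin (n + h + h) → Bool := fun q =>
    if hq : n + h ≤ (q.1 : ℕ) ∧ n + h ≤ (q.2 : ℕ) then
      y (⟨q.1 - (n + h), by omega⟩, ⟨q.2 - (n + h), by omega⟩) else pat q with hx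
  have hX1 : ∀ q, ¬ (n + h ≤ (q.1 : ℕ) ∧ n + h ≤ (q.2 : ℕ)) → x q = pat q := fun q hq => by
    simp only [hx, dif_neg hq]
  have hX2 : ∀ q, ∀ hq : n + h ≤ (q.1 : ℕ) ∧ n + h ≤ (q.2 : ℕ),
      x q = y (⟨q.1 - (n + h), by omega⟩, ⟨q.2 - (n + h), by omega⟩) := fun q hq => by
    simp only [hx, dif_pos hq]
  apply decide_eq_decide.2
  -- row and column `0` of the planted input
  have hrow : ∀ (h0 : 0 < n + h + h) (u : Fin (n + h + h)),
      x (⟨0, h0⟩, u) = true ↔ n ≤ (u : ℕ) ∧ (u : ℕ) < n + h := by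
    intro h0 u
    rw [hX1 (⟨0, h0⟩, u) (fun hh => absurd hh.1 (by show ¬ (n + h ≤ 0); omega))]
    exact hP2 (⟨0, h0⟩, u) rfl
  have hcol : ∀ (h0 : 0 < n + h + h) (u : Fin (n + h + h)), x (u, ⟨0, h0⟩) = false := by
    intro h0 u
    rw [hX1 (u, ⟨0, h0⟩) (fun hh => absurd hh.2 (by show ¬ (n + h ≤ 0); omega))]
    exact hP4 (u, ⟨0, h0⟩) rfl
  have hF0 : ∀ u : Fin (n + h + h), n ≤ (u : ℕ) →
      ((∃ h0 : 0 < n + h + h, (SimpleGraph.fromRel fun u v => x (u, v) = true).Adj ⟨0, h0⟩ u) ↔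
        (u : ℕ) < n + h) := by
    intro u hu
    constructor
    · rintro ⟨h0, hadj⟩
      rw [SimpleGraph.fromRel_adj] at hadj
      obtain ⟨-, h1 | h1⟩ := hadj
      · exact ((hrow h0 u).1 h1).2
      · rw [hcol h0 u] at h1
        exact absurd h1 Bool.false_ne_true
    · intro hu'
      refine ⟨by omega, ?_⟩
      rw [SimpleGraph.fromRel_adj]
      exact ⟨fun heq => absurd (congrArg Fin.val heq) (by show (0 : ℕ) ≠ (u : ℕ); omega),
        Or.inl ((hrow _ u).2 ⟨hu, hu'⟩)⟩
  have hFA : ∀ u : Fin (n + h + h),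
      (n + h + h ≤ (u : ℕ) + (h + h) ∧ ∃ h0 : 0 < n + h + h,
          (SimpleGraph.fromRel fun u v => x (u, v) = true).Adj ⟨0, h0⟩ u) ↔
        n ≤ (u : ℕ) ∧ (u : ℕ) < n + h := fun u =>
    ⟨fun hu => ⟨by omega, (hF0 u (by omega)).1 hu.2⟩, fun hu => ⟨by omega, (hF0 u hu.1).2 hu.2⟩⟩
  have hFB : ∀ u : Fin (n + h + h),
      (n + h + h ≤ (u : ℕ) + (h + h) ∧ ¬ ∃ h0 : 0 < n + h + h,
          (SimpleGraph.fromRel fun u v => x (u, v) = true).Adj ⟨0, h0⟩ u) ↔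
        n + h ≤ (u : ℕ) ∧ (u : ℕ) < n + h + h := by
    intro u
    constructor
    · rintro ⟨h1, h2⟩
      rw [hF0 u (by omega)] at h2
      exact ⟨by omega, u.2⟩
    · rintro ⟨h1, -⟩
      exact ⟨by omega, by rw [hF0 u (by omega)]; omega⟩
  obtain ⟨eA, heA⟩ := exists_blockEquiv n (show n + h ≤ n + h + h by omega) _ hFA
  obtain ⟨eB, heB⟩ := exists_blockEquiv (n + h) (show n + h + h ≤ n + h + h from le_rfl) _ hFB
  have iA := nonempty_induce_iso (fun u v => x (u, v) = true) _ H eA (fun a b => by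
    obtain ⟨ha1, ha2⟩ := (hFA a.1).1 a.2
    obtain ⟨hb1, hb2⟩ := (hFA b.1).1 b.2
    have ea : eA a = ⟨((a : Fin (n + h + h)) : ℕ) - n, by omega⟩ := Fin.ext (heA a)
    have eb : eA b = ⟨((b : Fin (n + h + h)) : ℕ) - n, by omega⟩ := Fin.ext (heA b)
    show x (a.1, b.1) = true ↔ _
    rw [hX1 (a.1, b.1) (fun hh => absurd hh.1
        (by show ¬ (n + h ≤ ((a : Fin (n + h + h)) : ℕ)); omega)),
      hP3 (a.1, b.1) ⟨ha1, ha2, hb1, hb2⟩, decide_eq_true_iff, ea, eb])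
  have iB := nonempty_induce_iso_fromRel (fun u v => x (u, v) = true) _
      (fun u v : Fin h => y (u, v) = true) eB (fun a b => by
    obtain ⟨ha1, ha2⟩ := (hFB a.1).1 a.2
    obtain ⟨hb1, hb2⟩ := (hFB b.1).1 b.2
    have ea : eB a = ⟨((a : Fin (n + h + h)) : ℕ) - (n + h), by omega⟩ := Fin.ext (heB a)
    have eb : eB b = ⟨((b : Fin (n + h + h)) : ℕ) - (n + h), by omega⟩ := Fin.ext (heB b)
    show x (a.1, b.1) = true ↔ _
    rw [hX2 (a.1, b.1) ⟨ha1, hb1⟩, ea, eb])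
  rw [nonempty_iso_congr iA iB]
  exact ⟨fun ⟨e⟩ => ⟨e.symm⟩, fun ⟨e⟩ => ⟨e.symm⟩⟩

end TwinIso

open TwinIso

/-- **HardToIdentify ⟹ TwinIsoHard** (registered stub `stub_twinIsoHard`, its statement verbatim as
the conclusion). If for every `c`, for infinitely many `h`, some graph `H` on `Fin h` has no
`Sym(Fin h)`-symmetric `tcBasis`-circuit with at most `2^{ch}` gates computing `y ↦ [Gr y ≅ H]`, then for
every polynomial `p`, for infinitely many `m`, no `Bud(m,⌊log₂ m⌋)`-symmetric `tcBasis`-circuit of size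
`≤ p m` computes the twin-isomorphism bit: take `m = 4^h` and plant `H` on the first free half
(`TwinIso.not_hasSymCircuit_twinIso_of_identifier`, `CoreReduction.exists_pow_bound`). With
`hardToIdentify_of_coreFooling` this refines `stub_twinIsoHard_of_coreFooling` through the intermediate
core HardToIdentify. -/
theorem twinIsoHard_of_hardToIdentify :
    (∀ c : ℕ, ∃ᶠ h in atTop, ∃ H : SimpleGraph (Fin h),
      ¬ HasSymCircuit tcBasis Set.univ (2 ^ (c * h))
        (fun x : Fin h × Fin h → Bool =>
          decide (Nonempty ((SimpleGraph.fromRel fun u v => x (u, v) = true) ≃g H)))) →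
    ∀ p : Polynomial ℕ, ∃ᶠ m in atTop,
      ¬ HasSymCircuit tcBasis (pointStabiliserBudget m (Nat.log 2 m)) (p.eval m)
        (fun x : Fin m × Fin m → Bool => decide (Nonempty
          (SimpleGraph.induce {u : Fin m | m ≤ (u : ℕ) + Nat.log 2 m ∧ ∃ h : 0 < m, (SimpleGraph.fromRel fun u v => x (u, v) = true).Adj ⟨0, h⟩ u}
              (SimpleGraph.fromRel fun u v => x (u, v) = true) ≃g
            SimpleGraph.induce {u : Fin m | m ≤ (u : ℕ) + Nat.log 2 m ∧ ¬ ∃ h : 0 < m, (SimpleGraph.fromRel fun u v => x (u, v) = true).Adj ⟨0, h⟩ u}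
              (SimpleGraph.fromRel fun u v => x (u, v) = true)))) := by
  intro hHTI p
  obtain ⟨d, g₀, hd⟩ := exists_pow_bound p
  rw [Filter.frequently_atTop]
  intro a
  obtain ⟨h, hha, H, hH⟩ := (Filter.frequently_atTop.1 (hHTI (2 * d))) (max a g₀)
  have hlt : h + h < 2 ^ (h + h) := Nat.lt_two_pow_self
  obtain ⟨n, hm⟩ : ∃ n : ℕ, n + h + h = 2 ^ (h + h) := ⟨2 ^ (h + h) - (h + h), by omega⟩
  have hn : 0 < n := by omega
  have hlog : Nat.log 2 (n + h + h) = h + h := by rw [hm, Nat.log_pow (by norm_num)]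
  have hbound : p.eval (n + h + h) + 2 ≤ 2 ^ (2 * d * h) := by
    rw [hm, show 2 * d * h = d * (h + h) by ring]
    exact hd (h + h) (by omega)
  refine ⟨n + h + h, by omega, ?_⟩
  refine not_hasSymCircuit_twinIso_of_identifier n h (Nat.log 2 (n + h + h)) (p.eval (n + h + h))
    hn hlog H (fun hsmall => hH ?_)
  obtain ⟨D, hDB, hDs, hDsym, hDcomp⟩ := hsmall
  exact ⟨D, hDB, hDs.trans hbound, hDsym, hDcomp⟩

end Summit.PneNP.PneNP.Theorems
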